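import Summits.BirchSwinnertonDyer.BirchSwinnertonDyer.Theorems.Rank1ResidualX10bMuTransfer
import Summits.BirchSwinnertonDyer.BirchSwinnertonDyer.Theorems.Rank1ResidualX10bMainConjecture
import HarnessLib

/-!
# Class X10b = N2 (`p = 3` good ordinary, `E[3]` irreducible, `ρ̄_{E,3}` NOT surjective): the CLASS
# LEAF `BSDpOnClassX10b`, the typed class-wide missing input `MazurMainConjectureOnClassX10b` (= X_A3)
# and Greenberg's analytic `μ = 0` on the class, with the kernel bridges — the `p = 3` twin of
# `Rank1ResidualX9Defs` / `Rank1ResidualX9MuTransfer` (rung K6, row A5 of the BSD ladder)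

HONEST FRAMING (cell `b2b-bsdres`, home `run/shared/lean/b2b/bsd-rank1-residual/`, unit
`b2b-bsdres-x10` = N2 class lead, GEN 35; verbatim in every file): the goal of the cell is to DELETE the
COMBINATION-SHAPED residual classes for ALL analytic-rank `≤ 1` curves over `ℚ` — "full BSD formula for
every rank `≤ 1` curve in class C" assembled STRICTLY from published theorems — so that the rank-`≤ 1`
remainder becomes exactly the CONSTRUCTION-SHAPED classes, which are TYPED (missing-input `Prop`s), NOT
attempted; this is not "finishing BSD". Research route; no claim beyond the stated class. NOTHING in this
file asserts anything about any curve: three `@[conjecture]` OBLIGATION NODES (typed `Prop`s, never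
asserted) and kernel bridges between them. X10b stays CONSTRUCTION-SHAPED (NEEDS X_A3); no census number,
mark or tier moves.

**Why this file (ladder BSD v1.3f, rung K6 "integral IMC for irreducible NON-surjective image", rows
A4 = X9 and A5 = X10b).** Row A4 has a registered leaf (`Rank1Residual.BSDpOnClassX9`,
`Theorems/Rank1ResidualX9Defs`) with the kernel bridge `bsdpOnClassX9_of_katoMuTransfer` (p407118) and
the rung route `route-BirchSwinnertonDyer-SmallImageMuTransfer`; row A5 had "no leaf of its own posted"
(PARTITION-SCOREBOARD v1 row A5) — only the PER-PAIR typings `Typed.X10.MissingInputAt W` /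
`Typed.X10b.MissingInputAt W` and the per-pair `μ`-transfer bridges (`Theorems/Rank1ResidualX10bMuTransfer`,
p407527, rank `0`; `X10/MuTransferThreeBothRanks`, p418354, both ranks). This file posts, for A5:

* `BSDpOnClassX10b` — the CLASS LEAF: for every globally minimal elliptic `W/ℚ` and prime `p` with
  `ClassX10 W p` (so `p = 3`, good ordinary, `E[3]` irreducible, analytic rank `0` off (ram) or `1` off
  semistability) and `ρ̄_{E,3}` NOT surjective, Miller's `BSDp W p` (OPEN; typed target);
* `MazurMainConjectureOnClassX10b` — the CLASS-WIDE typed missing input X_A3: Mazur's integral cyclotomic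
  main conjecture (prover A's Néron normalisation, `Rank1ResidualX1Defs.MazurMainConjecture`) at every
  X10b pair (OPEN; "[BS24]" announced for `p ≥ 5` only; Yan–Zhu 2026 Thm. 4.15 needs (Im));
* `AnalyticMuZeroOnClassX10b` — Greenberg's Conj. 1.11 on the ANALYTIC side at `3` on the class: one
  `3`-adic unit coefficient of `L_3(f, α)` for every X10b pair and newform (OPEN as a class statement;
  per pair a finite exact modular-symbol computation, certified on the lane's records);

and the KERNEL BRIDGES (theorems):

* `bsdpOnClassX10b_of_mazurMainConjectureOnClassX10b` — **A5 ⟸ X_A3 + the Schneider rider**: the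
  PUBLISHED record (Perrin-Riou–Schneider / Perrin-Riou 1987 / Mazur–Tate σ at odd `p`, Greenberg LNM
  1716 Thm. 4.1, modularity, GZK) ∧ `MazurMainConjectureOnClassX10b` ∧ Schneider's non-degeneracy at
  the rank-`1` X10b pairs (`hC3`, rider I1) ⟹ `BSDpOnClassX10b` (x10 GEN 6's
  `X10.bsdp_three_of_mazurMainConjecture`, per pair);
* `mazurMainConjectureOnClassX10b_of_katoMuTransferThree` — **X_A3 ⟸ the `μ`-transfer**: the rational
  main conjecture at `3` (Yan–Zhu 2026 Thm. 4.9, named fact `hYZ`, PUB, flag `YZ26@3-BF-ERL-Ohta`) ∧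
  period units ∧ modularity ∧ `KatoMuTransferThree` (cell `bsd-smallim`, KOLY-MEMO §5.7 at `p = 3`,
  OPEN node) ∧ `AnalyticMuZeroOnClassX10b` ⟹ `MazurMainConjectureOnClassX10b`;
* `bsdpOnClassX10b_of_katoMuTransferThree` — the composite: **A5 ⟸ `KatoMuTransferThree` ∧
  `AnalyticMuZeroOnClassX10b` ∧ Schneider-on-X10b-rank-1 ∧ PUBLISHED facts (incl. `hYZ`)** — the
  `p = 3` companion of `bsdpOnClassX9_of_katoMuTransfer`, i.e. the K6 decomposition of row A5 into the
  same three crux shapes as row A4 (μ-transfer · analytic μ = 0 · Schneider rider) plus one flagged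
  published input (the rational main conjecture at `3`);
* `bsdp_of_bsdpOnClassX10b`, `missingInputAt_of_bsdpOnClassX10b` — bookkeeping: the leaf delivers the
  per-pair `BSDp W 3` and the typed outputs `Typed.X10.MissingInputAt W` / `Typed.X10b.MissingInputAt W`.

Where `3` enters: only through `ClassX10`. What is NOT claimed: no node is asserted; no class is closed;
the flag on `hYZ` rides with every conclusion that uses it (the flag-free roads are in
`X10/MuTransferThreeEulerHalf`: Euler-system half in both ranks, X_A3 ⟺ `BSD(E,3)` at rank `0`).

References: [Kato2004Asterisque] Thm. 12.6, 17.4, 17.13; [GreenbergLNM1716] §1 Conj. 1.11, Thm. 4.1;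
[GreenbergVatsal2000] Prop. 3.7; [PerrinRiou1987] §1.4 Cor. 1.8; [BalakrishnanMullerStein2015] Thm. 1.7;
[CastellaEtAl2021] Thm. 5.1.4; [YanZhu2024MainConjNonCM] Thm. 4.9, Thm. 4.15; [Miller2011LMS] Def. 1.1;
[BurungaleCastellaSkinner2025] (im); cell files X10-AUDIT.md §12, §41; HOME/pub/bsd-smallim/koly/KOLY-MEMO.md §5.7.
-/

set_option autoImplicit false

noncomputable section

open scoped Classical MatrixGroups ModularForm

open CongruenceSubgroup WeierstrassCurve Literature.NumberTheory.EllipticCurves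
  Literature.NumberTheory.EllipticCurves.ModularForms Literature.NumberTheory.EllipticCurves.Rank1Residual
  Literature.NumberTheory.EllipticCurves.Rank1Residual.Typed
  Literature.NumberTheory.EllipticCurves.Wuthrich2014
  Summit.BirchSwinnertonDyer.BirchSwinnertonDyer.Theorems.Rank1ResidualX1Defs
  Summit.BirchSwinnertonDyer.BirchSwinnertonDyer.Rank1Residual

namespace Summit.BirchSwinnertonDyer.Rank1Residual.X10

/-! ### The three typed nodes of row A5 -/

/-- **TYPED TARGET — the class leaf of row A5 = X10b = N2 (OPEN; construction-shaped; nothing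
asserted).** "For every globally minimal elliptic `W/ℚ` and prime `p` with `ClassX10 W p` (`p = 3`, good
ordinary at `3`, `E[3]` irreducible, analytic rank `0 ∧ ¬(ram)` or `1 ∧ ¬semistable`) whose mod-`3`
representation is NOT surjective (image a Cartan normaliser `3Ns`/`3Nn`), Miller's `BSD(E,p)` holds."
No published theorem reaches it: Kato's integral clause 17.4 (3) needs `3`-adic surjectivity, Wuthrich
2014 Prop. 21 exempts these primes, Skinner–Urban's (ram) fails structurally
(`ClassX10.not_ram_of_not_surj`), Yan–Zhu 2026 Thm. 4.15 needs (Im) (`ClassX10.not_bigIm_of_not_surj`).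
BSD predicts it. The `p = 3` twin of `Rank1Residual.BSDpOnClassX9`, in the cell's canonical currency
`BSDp`. [cite: Miller2011LMS, §1 and Def. 1.1 (arXiv:1010.2431 p. 3) (shape only; nothing asserted)]
[cite: YanZhu2024MainConjNonCM, Thm. 4.15 (§4.6), hypothesis (Im) (shape only; nothing asserted)] -/
@[conjecture] def BSDpOnClassX10b : Prop :=
  ∀ (W : WeierstrassCurve ℚ) [W.IsElliptic] [W.IsGloballyMinimal] (p : ℕ) [Fact p.Prime],
    ClassX10 W p → ¬ Surj W 3 → BSDp W p

/-- **TYPED CLASS-WIDE MISSING INPUT X_A3 of row A5 (OPEN; nothing asserted).** Mazur's integral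
cyclotomic main conjecture at `(E, 3)` in prover A's Néron normalisation
(`Rank1ResidualX1Defs.MazurMainConjecture W p`: `X(E/ℚ_∞)` is `Λ`-torsion and `char_Λ X = (g)` with
`ι g = ϖ · L_3(f, α)`, `ϖ · Ω_E = Ω⁺_f`, for every cyclotomic datum and the newform of level `N_E`) at
EVERY X10b pair. In print: the RATIONAL statement (Yan–Zhu 2026 Thm. 4.9, flag `YZ26@3-BF-ERL-Ohta`;
Kato 17.4 (2) one-sidedly); the INTEGRAL one only under (Im)/surjectivity (Yan–Zhu Thm. 4.15, Kato 17.4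
(3)) — both unsatisfiable here — or as the announced "[BS24]" (residually dihedral `p ≥ 5`, not out).
Per pair the cell holds X_A3 on 180 of the 313 N2 cells of the census by TRIVIAL roads (unit / CM
partner / Tamagawa-free unit partner, `class-closure/N2/`), and modulo Greenberg's `μ = 0` at the pair on
the 133 others (GEN 34). [cite: GreenbergLNM1716, §1 Conj. 1.11 (shape only; nothing asserted)]
[cite: YanZhu2024MainConjNonCM, Thm. 4.9 (§4.4) and Thm. 4.15 (§4.6) (shape only; nothing asserted)] -/
@[conjecture] def MazurMainConjectureOnClassX10b : Prop :=
  ∀ (W : WeierstrassCurve ℚ) [W.IsElliptic] [W.IsGloballyMinimal] (p : ℕ) [Fact p.Prime],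
    ClassX10 W p → ¬ Surj W 3 → MazurMainConjecture W p

/-- **Greenberg's `μ = 0`, ANALYTIC side, on class X10b (OPEN as a class statement; certified per pair;
nothing asserted).** For every X10b pair `(W, p)` (`ClassX10 W p`, `¬ Surj W 3`) and every newform `f`
of `W`, some coefficient of the cyclotomic `3`-adic `L`-function `L_3(f, α)` (`α` the unit root) is a
`3`-adic unit (`L_3 ∉ 3Λ`). Greenberg LNM 1716 Conj. 1.11 is stated on the algebraic side; under the
main conjecture the two agree. Per pair it is a finite exact modular-symbol computation (the lane's
two-engine `μ`-certificates at `3`). The `p = 3` twin of `Rank1Residual.AnalyticMuZeroOnClassX9`; the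
programme's barrier B3 at `3`. [cite: GreenbergLNM1716, §1 Conj. 1.11 (shape only; nothing asserted)] -/
@[conjecture] def AnalyticMuZeroOnClassX10b : Prop :=
  ∀ (W : WeierstrassCurve ℚ) [W.IsElliptic] [W.IsGloballyMinimal] (p : ℕ) [Fact p.Prime]
    {N : ℕ} [NeZero N] (f : CuspForm (Gamma0 N) 2),
    ClassX10 W p → ¬ Surj W 3 → IsNewformOf W f →
    ∃ n : ℕ, ‖PowerSeries.coeff n (padicLFunction f (unitRoot W p : ℚ_[p]))‖ = 1

/-! ### Bookkeeping: what the leaf delivers per pair -/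

/-- The class leaf delivers Miller's `BSD(E,3)` at every X10b pair (instantiation). [folklore] -/
theorem bsdp_of_bsdpOnClassX10b (h : BSDpOnClassX10b)
    (W : WeierstrassCurve ℚ) [W.IsElliptic] [W.IsGloballyMinimal] (p : ℕ) [Fact p.Prime]
    (hX : ClassX10 W p) (hns : ¬ Surj W 3) : BSDp W p :=
  h W p hX hns

/-- The class leaf inhabits both per-pair typed outputs of the cell at every X10b pair:
`Typed.X10.MissingInputAt W` (x10's typing of class X10: `¬Surj W 3 → MissingPPartAt W 3`) and
`Typed.X10b.MissingInputAt W` (`= MissingPPartAt W 3`, the merged X9 ∪ X10b currency). GZK (`hGZK`)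
supplies `Finite Ш`. Bookkeeping. [cite: Miller2011LMS, Def. 1.1] -/
theorem missingInputAt_of_bsdpOnClassX10b (h : BSDpOnClassX10b)
    (hGZK : rank_eq_analyticRank_of_analyticRank_le_one)
    (W : WeierstrassCurve ℚ) [W.IsElliptic] [W.IsGloballyMinimal] (p : ℕ) [Fact p.Prime]
    (hX : ClassX10 W p) (hns : ¬ Surj W 3) :
    Typed.X10.MissingInputAt W ∧ Typed.X10b.MissingInputAt W := by
  have hbsd := h W p hX hns
  obtain ⟨hp3, -⟩ := id hX
  subst hp3
  haveI : Finite W.sha := (hGZK W (ClassX10.analyticRank_le_one hX)).2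
  have hX10 : Typed.X10.MissingInputAt W := Typed.X10.missingInputAt_of_bsdp W hbsd
  exact ⟨hX10, (Typed.X10b.missingInputAt_iff_x10 W hns).mpr hX10⟩

/-! ### A5 ⟸ X_A3 + the Schneider rider (published record otherwise) -/

/-- **Row A5 from its typed missing input: `MazurMainConjectureOnClassX10b` ∧ the Schneider rider ⟹
`BSDpOnClassX10b`.** PUBLISHED binders: Perrin-Riou–Schneider at odd `p` (`hS`, BMS 2016 Thm. 1.7),
Perrin-Riou 1987 §1.4 (`hPR`), the Mazur–Tate σ at odd `p` (`hMT`), Greenberg LNM 1716 Thm. 4.1 (`hGr`),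
modularity (`hmod`), Gross–Zagier–Kolyvagin (`hGZK`). RIDER (I1): Schneider's non-degeneracy of THE
canonical cyclotomic `3`-adic height at the rank-`1` X10b pairs (`hC3`; per pair `[T¹]L_3 ≠ 0`). Per
pair this is x10 GEN 6's `X10.bsdp_three_of_mazurMainConjecture` (rank `0`: CGLS's valuation chain;
rank `1`: unit x1b's odd-prime engine, no image hypothesis). [cite: PerrinRiou1987, §1.4 Cor. 1.8]
[cite: BalakrishnanMullerStein2015, Thm. 1.7] [cite: GreenbergLNM1716, Thm. 4.1 (p. 102)]
[cite: CastellaEtAl2021, Thm. 5.1.4 and its proof (§5.1.3)] [cite: Miller2011LMS, Def. 1.1 (arXiv:1010.2431 p. 3)] -/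
theorem bsdpOnClassX10b_of_mazurMainConjectureOnClassX10b
    (hS : Schneider1985_order_charGenerator_odd) (hPR : perrinRiou_rankOne_leadingTerms_odd)
    (hMT : mazur_tate_sigma_exists_odd) (hGr : greenberg_charValue_rankZero)
    (hmod : nonempty_modularParametrizationData)
    (hGZK : rank_eq_analyticRank_of_analyticRank_le_one)
    (hC3 : ∀ (W : WeierstrassCurve ℚ) [W.IsElliptic] [W.IsGloballyMinimal] (p : ℕ) [Fact p.Prime],
      ClassX10 W p → ¬ Surj W 3 → W.analyticRank = 1 →
        ∀ Dh : PAdicHeightData W p, Dh.IsCanonical → SchneiderConjecture Dh)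
    (hA3 : MazurMainConjectureOnClassX10b) : BSDpOnClassX10b := by
  intro W _ _ p _ hX hns
  have hMC := hA3 W p hX hns
  have hSch := hC3 W p hX hns
  obtain ⟨hp3, -⟩ := id hX
  subst hp3
  exact Summit.BirchSwinnertonDyer.BirchSwinnertonDyer.Theorems.Rank1ResidualX10bMainConjecture.X10.bsdp_three_of_mazurMainConjecture
    W hS hPR hMT hGr hmod hGZK hX hSch hMC

/-! ### X_A3 ⟸ the `μ`-transfer at `3` (KOLY-MEMO §5.7) + analytic `μ = 0` + the rational main conjecture -/

/-- **X_A3 on the class from the `μ`-transfer, with the rational main conjecture as a POINTWISE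
hypothesis on the class (`hrat`; no named fact)**: period units `h5`/`h3` ∧ modularity `hmodP` ∧
`KatoMuTransferThree` ∧ `AnalyticMuZeroOnClassX10b` ⟹ `MazurMainConjectureOnClassX10b`. Per pair:
`x10b_mu_eq_zero_of_katoMuTransferThree` (`μ = 0` for all cyclotomic data) into x9 GEN 5's
`mazurMainConjecture_neron_of_mu_eq_zero_of_rationalMC` (certificate in the `ϖ`-shape by `‖ϖ‖₃ = 1`).
[cite: GreenbergVatsal2000, Prop. 3.7 and §3 Remark (3.4)] [cite: GreenbergLNM1716, §1 Conj. 1.11]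
[cite: Kato2004Asterisque, Thm. 12.6 and 17.13 (p. 280)] -/
theorem mazurMainConjectureOnClassX10b_of_katoMuTransferThree_of_rationalMC
    (hrat : ∀ (W : WeierstrassCurve ℚ) [W.IsElliptic] [W.IsGloballyMinimal] (p : ℕ) [Fact p.Prime],
      ClassX10 W p → ¬ Surj W 3 →
      ∀ (κ : ZpExtension ℚ p) (γ : Field.absoluteGaloisGroup ℚ) {N : ℕ} [NeZero N]
        (f : CuspForm (Gamma0 N) 2), κ.IsCyclotomic → κ.IsTopGenerator γ → IsCyclotomicVariable p γ →
        IsNewformOf W f → ∀ (D : W.SelmerDualData κ γ), D.IsTorsion ∧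
          ∃ (g : IwasawaAlgebra p) (k : ℤ), D.charIdeal = Ideal.span {g} ∧
            iwasawaToPowerSeries p g =
              PowerSeries.C ((p : ℚ_[p]) ^ k) * padicLFunction f (unitRoot W p : ℚ_[p]))
    (h5 : realPeriodRat_eq_unit_mul_plusPeriod) (h3 : realPeriodRat_eq_unit_mul_plusPeriod_three)
    (hmodP : nonempty_modularParametrizationData)
    (hT3 : KatoMuTransferThree) (hA : AnalyticMuZeroOnClassX10b) : MazurMainConjectureOnClassX10b := by
  intro W _ _ p _ hX hns
  have hcertA : ∀ {N : ℕ} [NeZero N] (f : CuspForm (Gamma0 N) 2), IsNewformOf W f →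
      ∃ n : ℕ, ‖PowerSeries.coeff n (padicLFunction f (unitRoot W p : ℚ_[p]))‖ = 1 :=
    fun f hf ↦ hA W p f hX hns hf
  have hμ := x10b_mu_eq_zero_of_katoMuTransferThree hmodP hT3 W p hX hns hcertA
  have hrat' := hrat W p hX hns
  obtain ⟨hp3, ⟨hgood, hord⟩, hirr, -⟩ := id hX
  subst hp3
  have hcert : ∀ [NeZero (W.conductorNorm ℤ)] (f : CuspForm (Gamma0 (W.conductorNorm ℤ)) 2),
      IsNewformOf W f → ∀ (ϖ : ℚ), (ϖ : ℝ) * W.realPeriodRat = plusPeriod f →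
      ∃ n : ℕ, ‖PowerSeries.coeff n
        (PowerSeries.C (ϖ : ℚ_[3]) * padicLFunction f (unitRoot W 3 : ℚ_[3]))‖ = 1 := by
    intro _ f hf ϖ hϖeq
    obtain ⟨n, hn⟩ := hcertA f hf
    refine ⟨n, ?_⟩
    rw [PowerSeries.coeff_C_mul, norm_mul,
      norm_periodRatio_eq_one_of_odd h5 h3 W 3 (by decide) hgood hirr f hf ϖ hϖeq, one_mul]
    exact hn
  exact mazurMainConjecture_neron_of_mu_eq_zero_of_rationalMC W 3 hrat' h5 h3 (by decide) hgood hord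
    hirr hμ hcert

/-- **X_A3 on the class from the `μ`-transfer: Yan–Zhu 2026 Thm. 4.9 (`hYZ`, PUB, flag
`YZ26@3-BF-ERL-Ohta`) ∧ period units ∧ modularity ∧ `KatoMuTransferThree` ∧ `AnalyticMuZeroOnClassX10b`
⟹ `MazurMainConjectureOnClassX10b`.** The flag rides with the conclusion.
[cite: YanZhu2024MainConjNonCM, Thm. 4.9 (§4.4)] [cite: GreenbergVatsal2000, Prop. 3.7]
[cite: Kato2004Asterisque, Thm. 12.6 and 17.13 (p. 280)] -/
theorem mazurMainConjectureOnClassX10b_of_katoMuTransferThree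
    (hYZ : YanZhu2026.thm49_charIdeal_eq_padicLFunction)
    (h5 : realPeriodRat_eq_unit_mul_plusPeriod) (h3 : realPeriodRat_eq_unit_mul_plusPeriod_three)
    (hmodP : nonempty_modularParametrizationData)
    (hT3 : KatoMuTransferThree) (hA : AnalyticMuZeroOnClassX10b) : MazurMainConjectureOnClassX10b := by
  refine mazurMainConjectureOnClassX10b_of_katoMuTransferThree_of_rationalMC ?_ h5 h3 hmodP hT3 hA
  intro W _ _ p _ hX _
  obtain ⟨hp3, ⟨hgood, hord⟩, hirr, -⟩ := id hX
  have hp2 : p ≠ 2 := by omega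
  have hgood' : W.HasGoodReductionAtPrime p := hp3 ▸ hgood
  have hord' : ¬ (p : ℤ) ∣ W.frobeniusTrace p := by subst hp3; exact hord
  have hirr' : W.HasIrreducibleModPGaloisRep p := by subst hp3; exact hirr
  exact rationalMC_of_yanZhu W p hYZ hp2 hgood' hord' hirr'

/-! ### The composite K6 bridge for row A5 -/

/-- **Row A5 from the three K6 crux shapes (KERNEL bridge; the `p = 3` companion of
`bsdpOnClassX9_of_katoMuTransfer`).** PUBLISHED binders: Yan–Zhu 2026 Thm. 4.9 (`hYZ`, PUB, flag
`YZ26@3-BF-ERL-Ohta` — the rational main conjecture at `3`), Greenberg LNM 1716 Thm. 4.1 (`hGr`), the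
period units (`h5`, `h3`), Perrin-Riou–Schneider (`hS`), Perrin-Riou 1987 (`hPR`), Mazur–Tate σ (`hMT`),
modularity (`hmodP`), Gross–Zagier–Kolyvagin (`hGZK`). CELL inputs (open nodes): `KatoMuTransferThree`
(the `μ`-transfer at `3`, KOLY-MEMO §5.7 / 5.7.3 (ii), paper) and `AnalyticMuZeroOnClassX10b` (barrier B3
at `3`). RIDER (I1): the Schneider certificate at the rank-`1` X10b pairs (`hC3`). Conclusion: the class
leaf `BSDpOnClassX10b`. Nothing is booked: the two cell inputs are open nodes and `hYZ` carries its flag.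
[cite: YanZhu2024MainConjNonCM, Thm. 4.9 (§4.4)] [cite: GreenbergLNM1716, Thm. 4.1 (p. 102) and §1 Conj. 1.11]
[cite: PerrinRiou1987, §1.4 Cor. 1.8] [cite: CastellaEtAl2021, Thm. 5.1.4 and its proof (§5.1.3)]
[cite: Miller2011LMS, §1 and Def. 1.1] -/
theorem bsdpOnClassX10b_of_katoMuTransferThree
    (hYZ : YanZhu2026.thm49_charIdeal_eq_padicLFunction)
    (hGr : greenberg_charValue_rankZero) (h5 : realPeriodRat_eq_unit_mul_plusPeriod)
    (h3 : realPeriodRat_eq_unit_mul_plusPeriod_three)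
    (hS : Schneider1985_order_charGenerator_odd) (hPR : perrinRiou_rankOne_leadingTerms_odd)
    (hMT : mazur_tate_sigma_exists_odd) (hmodP : nonempty_modularParametrizationData)
    (hGZK : rank_eq_analyticRank_of_analyticRank_le_one)
    (hT3 : KatoMuTransferThree) (hA : AnalyticMuZeroOnClassX10b)
    (hC3 : ∀ (W : WeierstrassCurve ℚ) [W.IsElliptic] [W.IsGloballyMinimal] (p : ℕ) [Fact p.Prime],
      ClassX10 W p → ¬ Surj W 3 → W.analyticRank = 1 →
        ∀ Dh : PAdicHeightData W p, Dh.IsCanonical → SchneiderConjecture Dh) :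
    BSDpOnClassX10b :=
  bsdpOnClassX10b_of_mazurMainConjectureOnClassX10b hS hPR hMT hGr hmodP hGZK hC3
    (mazurMainConjectureOnClassX10b_of_katoMuTransferThree hYZ h5 h3 hmodP hT3 hA)

end Summit.BirchSwinnertonDyer.Rank1Residual.X10

end
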